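import Summits.AtomisticToContinuum.FouriersLaw.Theses.NoHiddenChargesKubo
import Literature.Barriers.AtomisticToContinuum.MazurBoundBallisticNarrow

/-!
# Support item `DrudeWeightExists` (stmt-AtomisticToContinuum-11916) from the representation stub alone

Companion to the two birth skeletons of the parity split of `ChargeCompleteness` (crux-strategist,
2026-08-17): the THIRD piece of the split, the route's existing support item `DrudeWeightExists`, is a
corollary of the shared stub `stub_representation` (GNS dictionary) by Suzuki's equality
`Mazur.tendsto_inv_mul_integral_inner` (Cesàro mean of `⟪U t ι f, ι f⟫` → `‖P ι f‖² ≥ 0`). So the whole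
split rests on: representation (provable plumbing) + `stub_conservedEven` + `stub_evenComplete` +
`stub_nondegenerate`. One stub only, hence not a registrable BC3 skeleton; filed as a workfile.
-/

noncomputable section

namespace Summit.AtomisticToContinuum.FouriersLaw.Cruxes.DrudeWeightExists.OfRepresentation

open Filter Set Function MeasureTheory
open scoped Topology BigOperators InnerProductSpace
open Literature.MathematicalPhysics.KineticTheory.HeatConduction
open Summit.AtomisticToContinuum.FouriersLaw.Theses.NoHiddenChargesKubo
open Literature.Barriers.AtomisticToContinuum

/-- stub (REPRESENTATION; verbatim the shared stub of the two birth skeletons). -/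
theorem stub_representation :
    ∀ ω₂ lam β γ : ℝ, 0 < ω₂ → 0 < lam → 0 < β → ∀ T : ℝ, 0 < T → ∀ μ : MeasureTheory.Measure Literature.MathematicalPhysics.KineticTheory.HeatConduction.ChainConfig, (Literature.MathematicalPhysics.KineticTheory.HeatConduction.pinnedChain ω₂ lam β γ).IsChainGibbsMeasure T μ → Literature.MathematicalPhysics.KineticTheory.HeatConduction.IsShiftInvariant μ → μ.map (fun σ : Literature.MathematicalPhysics.KineticTheory.HeatConduction.ChainConfig => fun x : ℤ => ((σ x).1, -(σ x).2)) = μ → ∀ D : Literature.MathematicalPhysics.KineticTheory.HeatConduction.InfiniteChainDynamics (Literature.MathematicalPhysics.KineticTheory.HeatConduction.pinnedChain ω₂ lam β γ), D.PreservesMeasure μ → (∀ t : ℝ, ∀ᵐ σ ∂μ, D.flow t (Literature.MathematicalPhysics.KineticTheory.HeatConduction.shift σ) = Literature.MathematicalPhysics.KineticTheory.HeatConduction.shift (D.flow t σ)) → let LocObs : (Literature.MathematicalPhysics.KineticTheory.HeatConduction.ChainConfig → ℝ) → Prop := fun f => ∃ (a : ℤ) (n : ℕ) (g : (Fin (n +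 1) → ℝ × ℝ) → ℝ), Continuous g ∧ (∃ (C : ℝ) (k : ℕ), ∀ v, |g v| ≤ C * (1 + ‖v‖) ^ k) ∧ ∀ σ, f σ = g (Literature.MathematicalPhysics.KineticTheory.HeatConduction.boxRestrictAt a n σ); let Cov : (Literature.MathematicalPhysics.KineticTheory.HeatConduction.ChainConfig → ℝ) → (Literature.MathematicalPhysics.KineticTheory.HeatConduction.ChainConfig → ℝ) → ℝ → ℤ → ℝ := fun f g t x => MeasureTheory.integral μ (fun σ => f (D.flow t σ) * g (fun y => σ (y + x))) - MeasureTheory.integral μ (fun σ => f (D.flow t σ)) * MeasureTheory.integral μ (fun σ => g (fun y => σ (y + x))); (∀ f g : Literature.MathematicalPhysics.KineticTheory.HeatConduction.ChainConfig → ℝ, LocObs f → LocObs g → (∀ (t : ℝ) (x : ℤ), MeasureTheory.Integrable (fun σ => f (D.flow t σ) * g (fun y => σ (y + x))) μ) ∧ (∀ t₀ : ℝ, ∃ m : ℤ → ℝ, Summable m ∧ ∀ t ∈ Set.Icc (0 : ℝ) t₀, ∀ x : ℤ, |Cov f g t x| ≤ m x) ∧ (∀ x : ℤ, Continuous (fun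 t : ℝ => Cov f g t x)) ∧ Continuous (fun t : ℝ => ∑' x : ℤ, Cov f g t x)) → ∃ (E : Type) (_ : NormedAddCommGroup E) (_ : InnerProductSpace ℝ E) (_ : CompleteSpace E) (U : ℝ → E →L[ℝ] E) (R : E →ₗᵢ[ℝ] E) (ι : (Literature.MathematicalPhysics.KineticTheory.HeatConduction.ChainConfig → ℝ) → E), Literature.Barriers.AtomisticToContinuum.Mazur.IsContractionSemigroup U ∧ (∀ f g : Literature.MathematicalPhysics.KineticTheory.HeatConduction.ChainConfig → ℝ, LocObs f → LocObs g → ∀ t : ℝ, 0 ≤ t → ⟪U t (ι f), ι g⟫_ℝ = ∑' x : ℤ, Cov f g t x) ∧ (∀ f g : Literature.MathematicalPhysics.KineticTheory.HeatConduction.ChainConfig → ℝ, LocObs f → LocObs g → ⟪ι f, ι g⟫_ℝ = ∑' x : ℤ, Cov f g 0 x) ∧ (∀ f : Literature.MathematicalPhysics.KineticTheory.HeatConduction.ChainConfig → ℝ, LocObs f → R (ι f) = ι (fun σ => f (fun x : ℤ => ((σ x).1, -(σ x).2)))) ∧ (∀ f : Literature.MathematicalPhysics.KineticTheory.HeatConduction.ChainConfig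 → ℝ, LocObs f → ∀ c : ℝ, ι (fun σ => c * f σ) = c • ι f) ∧ Dense ((Submodule.span ℝ (ι '' {f | LocObs f}) : Submodule ℝ E) : Set E) := by
  sorry

/-- `DrudeWeightExists` from the representation, by Suzuki's equality. [folklore] -/
theorem DrudeWeightExists_of : DrudeWeightExists := by
  have hRep := stub_representation
  intro ω₂ lam β γ hω hl hβ T hT μ hμG hμS hμR D hD hcomm LocObs Cov hcl f hf
  obtain ⟨E, i1, i2, i3, U, R, ι, hU, hdyn, hstat, hR, hlin, hdense⟩ :=
    hRep ω₂ lam β γ hω hl hβ T hT μ hμG hμS hμR D hD hcomm hcl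
  refine ⟨‖(Mazur.invariantSubspace U).starProjection (ι f)‖ ^ 2, sq_nonneg _, ?_⟩
  refine (Mazur.tendsto_inv_mul_integral_inner hU (ι f)).congr' ?_
  filter_upwards [eventually_ge_atTop (0 : ℝ)] with τ hτ
  congr 1
  apply intervalIntegral.integral_congr
  intro t ht
  rw [Set.uIcc_of_le hτ] at ht
  exact hdyn f f hf hf t ht.1

end Summit.AtomisticToContinuum.FouriersLaw.Cruxes.DrudeWeightExists.OfRepresentation

end
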